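import Literature.MathematicalPhysics.QuantumFieldTheory.Balaban1983to89.B6Ineq2118TwoScaleV1

/-!
# `Balaban1983to89.B6Ineq2118TwoScaleV1Plaq` — T. Bałaban, *Propagators and renormalization transformations for lattice gauge
# theories. II*, Commun. Math. Phys. **96** (1984) 223–250 [Balaban1984PropagatorsII], p. 243 (2.118), with [4] = *… I*, Commun. Math. Phys.
# **95** (1984) 17–40 [Balaban1984PropagatorsI] (1.66)–(1.67) p. 29: **`‖∂₁B‖²` of (2.118)/(1.67) IS the unit-lattice plaquette sum
# `Σ_{p⊂T^{(j)}} |(∂₁B)(p)|²` of the V1 calculus**, hence (2.118) for the concrete `tsV1` in pure V1 vocabulary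

statement-level skeleton of published theorems with citation tags; proofs where landed; nothing here is a claim about the Yang–Mills mass gap

PDF held: `paper:balaban1984-cmp96-propagators-rt-ii` (journal page = PDF page + 222; p. 243 [PDF 21], materialised text, this session) and
`paper:balaban1984-cmp95-propagators-rt-i` (p. 29 [PDF 13], text layer).

PRINT (verbatim).  [B6] p. 243: *"the quadratic forms are equal to ⟨B, Δ_jB⟩ given by (1.66) and satisfying (1.67): γ₀‖∂₁B‖² ≦ ⟨B, Δ_jB⟩ ≦
γ₁‖∂₁B‖². (2.118)"*; [B5] p. 29: *"⟨B, Δ_kB⟩ = … = ½Σ_{μ,ν}(2π)^{−d}∫dp′[…]⁻¹|(∂₁B)~_{μν}(p′)|². (1.66) … γ₀⟨∂₁B, ∂₁B⟩ ≦ ⟨B, Δ_kB⟩ ≦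
γ₁⟨∂₁B, ∂₁B⟩. (1.67)"*; p. 18: *"(∂A)(p) = … = (∂_μA_ν)(x) − (∂_νA_μ)(x) (1.2) … S(A) = ½Σ_p|(∂A)(p)|² (1.5)"* (unit lattice).

CITATION HEADER (lean-in-tree rule) — WHAT IS REPRODUCED.  Phase-2 file of the `lit-balaban` typed skeleton (HOME
`run/shared/lean/pub/lit-balaban/`), seat **p22 gen 10** (B6 fold owner r03, referee ref-4).  KNITTING of SKELETON rows **B6.Eq2.118** (this
seat's `…B6Ineq2118TwoScaleV1.ineq2118_V1`, p299847: (2.118) for `tsV1` with `‖∂₁B‖² = …B5Bounds167Lattice.d1Sq (Mk P j) (cplx (tB B))`, the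
(1.66)/(1.67) object of record of the B5 lineage — untouched) with the V1 lattice calculus of `…LatticeFieldCalculus` (r18: `curl`,
`curlAction` — untouched):
* §1 the unit-lattice curl form of (1.66)/(1.67), `⟨∂₁B, ∂₁B⟩ = ½Σ_{μ,ν}Σ_x|(∂₁B)_{μν}(x)|²` on the torus carriers `Tor (Mk P j) × Fin d → ℂ`
  of the transported field `B̃ = cplx (tB B)`, IS `Σ_{p : Plaq P j} ((∂₁B)(p))²` — each unoriented plaquette once, the (1.2)/(1.5) curl with
  unit factor (`d1Sq_tB_eq_sum_plaq`; antisymmetry in `(μ, ν)`, vanishing diagonal) — `= 2·S_{1,1}(B)` (`d1Sq_tB_eq_two_mul_curlAction`);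
* §2 **(2.118) FOR `tsV1` IN V1 VOCABULARY: `κΣ_p((∂₁B)(p))² ≤ ⟨B, Δ_jB⟩ ≤ κγ₁Σ_p((∂₁B)(p))²`** (`ineq2118_V1_plaq`; `κ = c²/(η^d L^{2j})`,
  `γ₁ = (π²/4)^{d+2}`), and with `d`-only constants at the printed normalisation `c² = η^{d−2}` (`ineq2118_V1_plaq_printed`).
THEOREMS ONLY (no definition, no `def … : Prop`, nothing is a named unproved fact; standard axioms).  HONEST SCOPE: an identification of
two typed presentations of `‖∂₁B‖²` plus the restatement of p299847's inequality; constants as there; NOT summit progress.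
-/

noncomputable section

open scoped InnerProductSpace BigOperators

namespace Literature.MathematicalPhysics.QuantumFieldTheory.Balaban1983to89.B6Ineq2118TwoScaleV1Plaq

open LatticeFieldCalculus B5Eq117TorusCarriers B5SectBStatements
open B5Prop11Plancherel (Tor unitVec)
open B5Bounds167Lattice (d1Sq)

variable {P : Params} {j : ℕ}

/-! ## §1  `⟨∂₁B, ∂₁B⟩` of (1.66)/(1.67) = the V1 plaquette sum `Σ_p |(∂₁B)(p)|²` -/

/-- on `T^{(j)}` (`Site P j` = `Tor (Mk P j)`): `x + e_μ` of the torus carriers is `Site.shift x μ`. [cite: Balaban1984PropagatorsI, (1.1) p.18] -/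
theorem shift_eq_add_unitVec (x : Tor (Mk P j)) (μ : Fin P.d) :
    (Site.shift (P := P) (j := j) x μ : Tor (Mk P j)) = x + unitVec (Mk P j) μ := by
  funext ν
  simp only [Pi.add_apply, unitVec, Site.shift]
  by_cases hν : ν = μ
  · subst hν
    rw [Function.update_self, Pi.single_eq_same]
  · rw [Function.update_of_ne hν, Pi.single_eq_of_ne hν, add_zero]

/-- the (1.66) curl component `(∂₁B̃)_{μν}(x)` of the transported field is the real number
`B(x,μ) + B(x+e_μ,ν) − B(x+e_ν,μ) − B(x,ν)` = the V1 plaquette curl (1.2) with unit factor. [cite: Balaban1984PropagatorsI, (1.2) p.18 + (1.66) p.29] -/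
theorem curl_cplx_tB (B : VecField P j ℝ) (μ ν : Fin P.d) (x : Site P j) :
    B5Bounds167Lattice.curl (Mk P j) (cplx (tB (P := P) (k := j) B)) μ ν x =
      (((B ⟨x, μ⟩ + B ⟨x.shift μ, ν⟩ - B ⟨x.shift ν, μ⟩ - B ⟨x, ν⟩ : ℝ)) : ℂ) := by
  simp only [B5Bounds167Lattice.curl, B5Action121.fdiff_mulVec_apply, B5Action121.sdiff_mulVec, B5Action121.comp, one_mul, cplx,
    tB_apply]
  rw [← shift_eq_add_unitVec, ← shift_eq_add_unitVec]
  push_cast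
  ring

/-- … so its squared modulus is the square of the V1 curl: `|(∂₁B̃)_{μν}(x)|² = ((∂₁B)(p_{μν}(x)))²` for `μ < ν`.
[cite: Balaban1984PropagatorsI, (1.2) p.18 + (1.66) p.29] -/
theorem norm_curl_cplx_tB_sq (B : VecField P j ℝ) (μ ν : Fin P.d) (x : Site P j) (h : μ < ν) :
    ‖B5Bounds167Lattice.curl (Mk P j) (cplx (tB (P := P) (k := j) B)) μ ν x‖ ^ 2 = curl 1 B ⟨x, μ, ν, h⟩ ^ 2 := by
  rw [curl_cplx_tB, Complex.norm_real, Real.norm_eq_abs, sq_abs]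
  simp only [curl, one_smul]

/-- the squared components are symmetric in `(μ, ν)` (the curl is antisymmetric). [cite: Balaban1984PropagatorsI, (1.2) p.18] -/
theorem norm_curl_cplx_tB_sq_symm (B : VecField P j ℝ) (μ ν : Fin P.d) (x : Site P j) :
    ‖B5Bounds167Lattice.curl (Mk P j) (cplx (tB (P := P) (k := j) B)) ν μ x‖ ^ 2 =
      ‖B5Bounds167Lattice.curl (Mk P j) (cplx (tB (P := P) (k := j) B)) μ ν x‖ ^ 2 := by
  rw [curl_cplx_tB, curl_cplx_tB, Complex.norm_real, Complex.norm_real, Real.norm_eq_abs, Real.norm_eq_abs, sq_abs, sq_abs]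
  ring

/-- the diagonal components vanish: `(∂₁B̃)_{μμ} = 0`. [cite: Balaban1984PropagatorsI, (1.2) p.18] -/
theorem curl_cplx_tB_diag (B : VecField P j ℝ) (μ : Fin P.d) (x : Site P j) :
    B5Bounds167Lattice.curl (Mk P j) (cplx (tB (P := P) (k := j) B)) μ μ x = 0 := by
  rw [curl_cplx_tB]
  push_cast
  ring

/-- a sum over the plaquettes of `T^{(j)}` is the sum over base points and ordered direction pairs `μ < ν`. [folklore] -/
private theorem sum_plaq_eq (g : Plaq P j → ℝ) :
    ∑ p : Plaq P j, g p = ∑ x : Site P j, ∑ μ : Fin P.d, ∑ ν : Fin P.d, if h : μ < ν then g ⟨x, μ, ν, h⟩ else 0 := by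
  set F : Site P j × Fin P.d × Fin P.d → ℝ := fun a => if h : a.2.1 < a.2.2 then g ⟨a.1, a.2.1, a.2.2, h⟩ else 0 with hFdef
  let e : {t : Site P j × Fin P.d × Fin P.d // t.2.1 < t.2.2} ≃ Plaq P j :=
    ⟨fun t => ⟨t.1.1, t.1.2.1, t.1.2.2, t.2⟩, fun p => ⟨(p.src, p.μ, p.ν), p.hμν⟩, fun _ => rfl, fun _ => rfl⟩
  have h1 : ∑ p : Plaq P j, g p = ∑ t : {t : Site P j × Fin P.d × Fin P.d // t.2.1 < t.2.2}, F t.1 := by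
    rw [← Equiv.sum_comp e]
    refine Fintype.sum_congr _ _ fun t => ?_
    simp only [hFdef, dif_pos t.2]
    rfl
  have h2 : ∑ t : {t : Site P j × Fin P.d × Fin P.d // t.2.1 < t.2.2}, F t.1 = ∑ a, F a := by
    rw [← Finset.sum_subtype (Finset.univ.filter fun t : Site P j × Fin P.d × Fin P.d => t.2.1 < t.2.2) (fun t => by simp) F,
      Finset.sum_filter]
    refine Finset.sum_congr rfl fun a _ => ?_
    by_cases h : a.2.1 < a.2.2
    · rw [if_pos h]
    · rw [if_neg h, hFdef]
      simp only [dif_neg h]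
  rw [h1, h2, Fintype.sum_prod_type]
  exact Finset.sum_congr rfl fun x _ => Fintype.sum_prod_type _

/-- a double sum of a symmetric function with vanishing diagonal is twice the sum over `μ < ν`. [folklore] -/
private theorem sum_sum_eq_two_mul_sum_lt (f : Fin P.d → Fin P.d → ℝ) (hsymm : ∀ μ ν, f ν μ = f μ ν) (hdiag : ∀ μ, f μ μ = 0) :
    ∑ μ, ∑ ν, f μ ν = 2 * ∑ μ, ∑ ν, if μ < ν then f μ ν else 0 := by
  have hsplit : ∀ μ ν, f μ ν = (if μ < ν then f μ ν else 0) + (if ν < μ then f μ ν else 0) := by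
    intro μ ν
    rcases lt_trichotomy μ ν with h | h | h
    · rw [if_pos h, if_neg (not_lt.mpr h.le), add_zero]
    · subst h
      rw [if_neg (lt_irrefl _), add_zero, hdiag]
    · rw [if_neg (not_lt.mpr h.le), if_pos h, zero_add]
  have hswap : ∑ μ, ∑ ν, (if ν < μ then f μ ν else 0) = ∑ μ, ∑ ν, (if μ < ν then f μ ν else 0) := by
    rw [Finset.sum_comm]
    refine Finset.sum_congr rfl fun μ _ => Finset.sum_congr rfl fun ν _ => ?_
    by_cases h : μ < ν
    · rw [if_pos h, if_pos h, hsymm]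
    · rw [if_neg h, if_neg h]
  calc ∑ μ, ∑ ν, f μ ν = ∑ μ, ∑ ν, ((if μ < ν then f μ ν else 0) + (if ν < μ then f μ ν else 0)) :=
        Finset.sum_congr rfl fun μ _ => Finset.sum_congr rfl fun ν _ => hsplit μ ν
    _ = ∑ μ, ∑ ν, (if μ < ν then f μ ν else 0) + ∑ μ, ∑ ν, (if ν < μ then f μ ν else 0) := by
        simp only [Finset.sum_add_distrib]
    _ = 2 * ∑ μ, ∑ ν, if μ < ν then f μ ν else 0 := by rw [hswap]; ring

/-- **`‖∂₁B‖²` of (1.66)/(1.67) IS the V1 plaquette sum**: `⟨∂₁B̃, ∂₁B̃⟩ = ½Σ_{μ,ν}Σ_x|(∂₁B̃)_{μν}(x)|² = Σ_{p⊂T^{(j)}} ((∂₁B)(p))²` for the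
transported field `B̃ = cplx (tB B)` (each unoriented plaquette once, unit-factor curl (1.2)). [cite: Balaban1984PropagatorsI, (1.66)–(1.67) p.29] -/
theorem d1Sq_tB_eq_sum_plaq (B : VecField P j ℝ) :
    d1Sq (Mk P j) (cplx (tB (P := P) (k := j) B)) = ∑ p : Plaq P j, curl 1 B p ^ 2 := by
  have hx : ∀ x : Site P j, ∑ μ : Fin P.d, ∑ ν : Fin P.d, ‖B5Bounds167Lattice.curl (Mk P j) (cplx (tB (P := P) (k := j) B)) μ ν x‖ ^ 2
      = 2 * ∑ μ : Fin P.d, ∑ ν : Fin P.d, if h : μ < ν then curl 1 B ⟨x, μ, ν, h⟩ ^ 2 else 0 := by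
    intro x
    rw [sum_sum_eq_two_mul_sum_lt (fun μ ν => ‖B5Bounds167Lattice.curl (Mk P j) (cplx (tB (P := P) (k := j) B)) μ ν x‖ ^ 2)
      (fun μ ν => norm_curl_cplx_tB_sq_symm B μ ν x) (fun μ => by rw [curl_cplx_tB_diag, norm_zero, sq, mul_zero])]
    congr 1
    refine Finset.sum_congr rfl fun μ _ => Finset.sum_congr rfl fun ν _ => ?_
    by_cases h : μ < ν
    · rw [if_pos h, dif_pos h, norm_curl_cplx_tB_sq B μ ν x h]
    · rw [if_neg h, dif_neg h]
  unfold d1Sq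
  rw [sum_plaq_eq]
  -- bring the site sum outside: `Σ_μ Σ_ν Σ_x = Σ_x Σ_μ Σ_ν`
  have hcomm : ∑ μ : Fin P.d, ∑ ν : Fin P.d, ∑ x : Tor (Mk P j), ‖B5Bounds167Lattice.curl (Mk P j) (cplx (tB (P := P) (k := j) B)) μ ν x‖ ^ 2
      = ∑ x : Site P j, ∑ μ : Fin P.d, ∑ ν : Fin P.d, ‖B5Bounds167Lattice.curl (Mk P j) (cplx (tB (P := P) (k := j) B)) μ ν x‖ ^ 2 :=
    calc ∑ μ : Fin P.d, ∑ ν : Fin P.d, ∑ x : Tor (Mk P j), ‖B5Bounds167Lattice.curl (Mk P j) (cplx (tB (P := P) (k := j) B)) μ ν x‖ ^ 2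
        = ∑ μ : Fin P.d, ∑ x : Site P j, ∑ ν : Fin P.d, ‖B5Bounds167Lattice.curl (Mk P j) (cplx (tB (P := P) (k := j) B)) μ ν x‖ ^ 2 :=
          Finset.sum_congr rfl fun μ _ => Finset.sum_comm
      _ = ∑ x : Site P j, ∑ μ : Fin P.d, ∑ ν : Fin P.d, ‖B5Bounds167Lattice.curl (Mk P j) (cplx (tB (P := P) (k := j) B)) μ ν x‖ ^ 2 :=
          Finset.sum_comm
  rw [hcomm, Finset.mul_sum]
  refine Finset.sum_congr rfl fun x _ => ?_
  rw [hx x]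
  ring

/-- … `= 2·S_{1,1}(B)`, twice the unit-lattice action (1.5) of the V1 calculus. [cite: Balaban1984PropagatorsI, (1.5) p.18 + (1.66) p.29] -/
theorem d1Sq_tB_eq_two_mul_curlAction (B : VecField P j ℝ) :
    d1Sq (Mk P j) (cplx (tB (P := P) (k := j) B)) = 2 * curlAction 1 1 B := by
  rw [d1Sq_tB_eq_sum_plaq, curlAction, Finset.mul_sum, Finset.mul_sum]
  refine Finset.sum_congr rfl fun p _ => ?_
  rw [Real.norm_eq_abs, sq_abs]
  ring

/-! ## §2  (2.118) for the concrete `Δ_j` of `tsV1` in V1 vocabulary -/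

section TwoScale

open B6SectCOperators B6SectCOperators.TwoScaleData B6SectCTwoScaleV1 B6SectCTwoScaleV1Lattice B6Ineq2118TwoScaleV1
open Beta.Ineq167OperatorUpper (gamma1)

variable {c : ℝ} (hc : c ≠ 0) (hj : j + 1 ≤ P.m + P.K) (Λ' : Finset (Site P (j + 1))) {w : CIdx j Λ' → ℝ} (hw : ∀ i, 0 < w i)

include hj hw

/-- **(2.118) FOR THE CONCRETE TWO-SCALE `Δ_j` OF `tsV1`, V1 VOCABULARY: `κΣ_p((∂₁B)(p))² ≤ ⟨B, Δ_jB⟩ ≤ κγ₁Σ_p((∂₁B)(p))²`**, the sums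
over the plaquettes of the unit lattice `T^{(j)}`, `∂₁ = curl 1`, `κ = c²/(η^d L^{2j})`, `γ₁ = (π²/4)^{d+2}`.
[cite: Balaban1984PropagatorsII, (2.118) p.243] -/
theorem ineq2118_V1_plaq (B : VecField P j ℝ) :
    c ^ 2 / (eta P.L j ^ P.d * ((P.L : ℝ) ^ j) ^ 2) * ∑ p : Plaq P j, curl 1 B p ^ 2
        ≤ ⟪WithLp.toLp 2 B, (tsV1 hc Λ' w).Δj (WithLp.toLp 2 B)⟫_ℝ ∧
      ⟪WithLp.toLp 2 B, (tsV1 hc Λ' w).Δj (WithLp.toLp 2 B)⟫_ℝ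
        ≤ c ^ 2 / (eta P.L j ^ P.d * ((P.L : ℝ) ^ j) ^ 2) * (gamma1 P.d * ∑ p : Plaq P j, curl 1 B p ^ 2) := by
  rw [← d1Sq_tB_eq_sum_plaq]
  exact ineq2118_V1 hc hj Λ' hw B

/-- the same with the unit-lattice action: `2κS_{1,1}(B) ≤ ⟨B, Δ_jB⟩ ≤ 2κγ₁S_{1,1}(B)`. [cite: Balaban1984PropagatorsII, (2.118) p.243] -/
theorem ineq2118_V1_curlAction (B : VecField P j ℝ) :
    c ^ 2 / (eta P.L j ^ P.d * ((P.L : ℝ) ^ j) ^ 2) * (2 * curlAction 1 1 B)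
        ≤ ⟪WithLp.toLp 2 B, (tsV1 hc Λ' w).Δj (WithLp.toLp 2 B)⟫_ℝ ∧
      ⟪WithLp.toLp 2 B, (tsV1 hc Λ' w).Δj (WithLp.toLp 2 B)⟫_ℝ
        ≤ c ^ 2 / (eta P.L j ^ P.d * ((P.L : ℝ) ^ j) ^ 2) * (gamma1 P.d * (2 * curlAction 1 1 B)) := by
  rw [← d1Sq_tB_eq_two_mul_curlAction]
  exact ineq2118_V1 hc hj Λ' hw B

/-- **(2.118) for `tsV1` at the printed normalisation `c² = η^{d−2}`, V1 vocabulary: `Σ_p((∂₁B)(p))² ≤ ⟨B, Δ_jB⟩ ≤ γ₁Σ_p((∂₁B)(p))²`**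
(`γ₀ = 1`, `γ₁ = (π²/4)^{d+2}` depending on `d` only). [cite: Balaban1984PropagatorsII, (2.118) p.243] -/
theorem ineq2118_V1_plaq_printed (hcη : c ^ 2 = eta P.L j ^ P.d * ((P.L : ℝ) ^ j) ^ 2) (B : VecField P j ℝ) :
    ∑ p : Plaq P j, curl 1 B p ^ 2 ≤ ⟪WithLp.toLp 2 B, (tsV1 hc Λ' w).Δj (WithLp.toLp 2 B)⟫_ℝ ∧
      ⟪WithLp.toLp 2 B, (tsV1 hc Λ' w).Δj (WithLp.toLp 2 B)⟫_ℝ ≤ gamma1 P.d * ∑ p : Plaq P j, curl 1 B p ^ 2 := by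
  have h := ineq2118_V1_plaq hc hj Λ' hw B
  rw [kappa_eq_one hcη, one_mul, one_mul] at h
  exact h

end TwoScale

end Literature.MathematicalPhysics.QuantumFieldTheory.Balaban1983to89.B6Ineq2118TwoScaleV1Plaq

end
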